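import Summits.AtomisticToContinuum.Crystallization.Theses.PRVarianceCertificate

/-!
# Route PRVarianceCertificate — item 11864 `CertificateBoundsEnergy`

Item `stmt-AtomisticToContinuum-11864` (support): the dilation / Cauchy–Schwarz algebra turning
the variance-form certificate `∑ᵢ sᵢ² ≤ C · ∑ᵢ tᵢ` (with `sᵢ = ∑_{k ≠ i} r_{ik}⁻⁶`,
`tᵢ = ∑_{k ≠ i} r_{ik}⁻¹²`) into the energy bound `𝓔_LJ(x) ≥ −(C/24)·N`.

PROOF.  Write `S = ∑ᵢ sᵢ`, `T = ∑ᵢ tᵢ`.  Double counting (`two_mul_interactionEnergy`) and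
linearity of the site energy in the potential give `2𝓔(x) = T/12 − S/6`.  Cauchy–Schwarz
(`sq_sum_le_card_mul_sum_sq`) and the certificate give `S² ≤ N · ∑ᵢ sᵢ² ≤ N·C·T`, whence
`(2S)² ≤ 4·(CN)·T ≤ (T + CN)²`, so `2S ≤ T + CN` (both sides nonnegative), i.e.
`T/12 − S/6 ≥ −CN/12`.  Injectivity of `x` is not needed.
-/

namespace Summit.AtomisticToContinuum.Crystallization.Theorems

open Literature.MathematicalPhysics.StatisticalMechanics

/-- **Item 11864 `CertificateBoundsEnergy`** (route `PRVarianceCertificate`, by name): if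
`0 ≤ C` and `∑ᵢ sᵢ² ≤ C·∑ᵢ tᵢ` for a configuration `x` of `N` points of `ℝᵈ`, then
`−(C/24)·N ≤ 𝓔_LJ(x)` (dilation bound `E = T/24 − S/12 ≥ −S²/(24T)` combined with Cauchy–Schwarz
`S² ≤ N ∑ sᵢ²`; the dilation step is the Lennard-Jones–Ingham 1925 lattice-sum optimisation in the
normalisation of Blanc–Lewin 2015, (3)). [cite: BlancLewin2015, §1.1 (3)] -/
theorem certificateBoundsEnergy_proof :
    Summit.AtomisticToContinuum.Crystallization.Theses.PRVarianceCertificate.CertificateBoundsEnergy := by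
  unfold Summit.AtomisticToContinuum.Crystallization.Theses.PRVarianceCertificate.CertificateBoundsEnergy
  intro C hC d N x _hx hcert
  -- linearity of the site energy in the potential: 𝓔ⁱ_LJ = tᵢ/12 - sᵢ/6
  have hsite : ∀ i, siteEnergy lennardJones x i =
      (1 / 12) * siteEnergy (fun r => (r⁻¹) ^ 12) x i
        - (1 / 6) * siteEnergy (fun r => (r⁻¹) ^ 6) x i := fun i => by
    simp only [siteEnergy, lennardJones, Finset.sum_sub_distrib, Finset.mul_sum]
  -- abbreviations
  set S : ℝ := ∑ i, siteEnergy (fun r => (r⁻¹) ^ 6) x i with hS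
  set T : ℝ := ∑ i, siteEnergy (fun r => (r⁻¹) ^ 12) x i with hT
  -- 2E = T/12 - S/6 (double counting)
  have hE : 2 * interactionEnergy lennardJones x = (1 / 12) * T - (1 / 6) * S := by
    rw [two_mul_interactionEnergy]
    simp only [hsite, Finset.sum_sub_distrib, ← Finset.mul_sum, hS, hT]
  -- nonnegativity of S and T
  have hS0 : 0 ≤ S := Finset.sum_nonneg fun i _ => Finset.sum_nonneg fun k _ => by positivity
  have hT0 : 0 ≤ T := Finset.sum_nonneg fun i _ => Finset.sum_nonneg fun k _ => by positivity
  have hN0 : (0 : ℝ) ≤ N := N.cast_nonneg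
  -- Cauchy–Schwarz: S² ≤ N · ∑ sᵢ²
  have hCS : S ^ 2 ≤ (N : ℝ) * ∑ i, (siteEnergy (fun r => (r⁻¹) ^ 6) x i) ^ 2 := by
    have h := sq_sum_le_card_mul_sum_sq (s := (Finset.univ : Finset (Fin N)))
      (f := fun i => siteEnergy (fun r => (r⁻¹) ^ 6) x i)
    rwa [Finset.card_univ, Fintype.card_fin] at h
  -- hence S² ≤ N·C·T
  have hS2 : S ^ 2 ≤ (N : ℝ) * (C * T) := hCS.trans (mul_le_mul_of_nonneg_left hcert hN0)
  -- (2S)² ≤ (T + C N)², so 2S ≤ T + C N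
  have h4 : (2 * S) ^ 2 ≤ (T + C * N) ^ 2 := by nlinarith [sq_nonneg (T - C * N)]
  have h5 : 2 * S ≤ T + C * N := by
    have hTN : 0 ≤ T + C * N := by positivity
    exact (sq_le_sq₀ (by positivity) hTN).1 h4
  -- conclude
  nlinarith [hE, h5]

end Summit.AtomisticToContinuum.Crystallization.Theorems
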